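import Summits.CriticalPhenomena.PercolationContinuityZ3.Theorems.PercAnnulusCrossingLandingStarts
import HarnessLib

/-!
# RSW3 lane: the LANDING-FOOTPRINT second-moment criterion for hard crossings (every `p`) —
# `E[L]² ≤ E[L²] · P_p(boxCross ![a,n,n] 0)`, hence pair quasi-multiplicativity of face-to-point connectivities ⇒ `HardCrossingLowerBound k`

builds on p205010 (kernel theorem, internal audit signed; external expert review pending)

RSW3 lane (LANE 3 `prim-rsw3`), lead seat, gen 5.  Helper file (`--supports`); no definitions, no named facts, no sorries.
Companion of the successful-starts series (`PercAnnulusCrossingLandingStarts*`), with the forward events dropped: for the block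
`P = {0..a}×{0..n}²` and a far-face site `v` (`v₀ = a`) the LANDING event `𝓛_v = {F₀ ↔ v inside P}` is itself a crossing of `P`, and
`L = #{v : 𝓛_v}` is the landing footprint of census Q21 (`E[L] = Σ_v τ_F(v)`, `E[L²] = Σ_{v,w} τ_F(v,w)` with the face-to-point and
face-to-two-points connectivities `τ_F(v) = P(𝓛_v)`, `τ_F(v,w) = P(𝓛_v ∩ 𝓛_w)`).  Cauchy–Schwarz for the counting variable of
`⋃_v 𝓛_v ⊆ boxCross ![a,n,n] 0` gives

* `landing_subset_boxCross`, `biUnion_landing_subset_boxCross` — a landed far-face site IS a crossing;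
* `sq_sum_landing_le` — **`(Σ_v τ_F(v))² ≤ P_p(boxCross ![a,n,n] 0) · Σ_{v,w} τ_F(v,w)`** (`E[L]² ≤ H·E[L²]`, every `p`);
* `le_real_boxCross_of_landing_secondMoment` — `Σ_{v,w} τ_F(v,w) ≤ K·(Σ_v τ_F(v))²`, `Σ_v τ_F(v) > 0` ⇒ `1/K ≤ P_p(boxCross ![a,n,n] 0)`;
* `hardCrossingLowerBound_of_landing_secondMoment` — at `p_c(ℤ³)`, a scale-uniform pair bound for the blocks `{0..kn}×{0..n}²` gives
  `HardCrossingLowerBound k`; `k = 1` is THE CUBE: uniform cube crossing ⇐ pair quasi-multiplicativity of the face-to-point function.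

This completes the lane's wall W5 (LADDER: "φ_{p_c}(S) ≥ 1 gives the first moment only; no second-moment upper bound at p_c in d = 3"):
the missing input is named as ONE inequality `Σ_{v,w} τ_F(v,w) ≤ K (Σ_v τ_F(v))²`.  Numerically (census Q21/§9, non-rigorous) the bound
certifies the fraction `1/(1 + CV²(L ∣ B))` of `H`, which is scale-invariant iff the law of `L/n` given the crossing is (PREREG §L-add-12 R22f).
[cite: LyonsPeres2016, §5.3 Prop. 5.11] [cite: Kesten1982, §3.3 (3.32)] [cite: GrimmettPercolation1999, §11.7]
-/

noncomputable section

namespace Summit.CriticalPhenomena.PercolationContinuityZ3.Theorems.Crossing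

open MeasureTheory Literature.Probability.LatticeModels Literature.Probability.Percolation SimpleGraph
open Summit.CriticalPhenomena.PercolationContinuityZ3.Theorems.SurfaceTension

/-- **A landed far-face site is a crossing:** `{F₀ ↔ v inside {0..a}×{0..n}²} ⊆ boxCross ![a,n,n] 0` for `v` in the block with `v₀ = a`.
[cite: Kesten1982, §3.3 (3.32)] -/
theorem landing_subset_boxCross {n a : ℕ} {v : Site 3} (hv : v ∈ Finset.Icc (0 : Site 3) ![(a : ℤ), n, n])
    (hv0 : v 0 = (a : ℤ)) :
    linked (↑(Finset.Icc (0 : Site 3) ![(a : ℤ), n, n]) : Set (Site 3))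
        {y : Site 3 | y ∈ Finset.Icc (0 : Site 3) ![(a : ℤ), n, n] ∧ y 0 = 0} {v} ⊆
      boxCross (![(a : ℤ), n, n] : Site 3) 0 := by
  refine Set.Subset.trans (linked_mono_right _ _ ?_) (linked_subset_boxCross (![(a : ℤ), n, n] : Site 3) 0)
  intro y hy
  rw [Set.mem_singleton_iff] at hy
  subst hy
  refine ⟨hv, ?_⟩
  rw [hv0]
  simp

/-- The union over the far face of the landing events is contained in the crossing (`{L ≥ 1} ⊆ boxCross`; in fact equal).
[cite: Kesten1982, §3.3 (3.32)] -/
theorem biUnion_landing_subset_boxCross (n a : ℕ) :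
    (⋃ v ∈ (Finset.Icc (0 : Site 3) ![(a : ℤ), n, n]).filter (fun y => y 0 = (a : ℤ)),
      linked (↑(Finset.Icc (0 : Site 3) ![(a : ℤ), n, n]) : Set (Site 3))
        {y : Site 3 | y ∈ Finset.Icc (0 : Site 3) ![(a : ℤ), n, n] ∧ y 0 = 0} {v}) ⊆
      boxCross (![(a : ℤ), n, n] : Site 3) 0 := by
  intro ω hω
  simp only [Set.mem_iUnion, exists_prop] at hω
  obtain ⟨v, hv, hωv⟩ := hω
  obtain ⟨hvP, hv0⟩ := Finset.mem_filter.1 hv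
  exact landing_subset_boxCross hvP hv0 hωv

/-- **Landing-footprint second-moment inequality (every `p`):**
`(Σ_{v ∈ F_a} P(F₀ ↔ v in P))² ≤ P_p(boxCross ![a,n,n] 0) · Σ_{v,w ∈ F_a} P(F₀ ↔ v ∧ F₀ ↔ w in P)`, i.e. `E[L]² ≤ H · E[L²]` for the
landing footprint `L` of the block `P = {0..a}×{0..n}²`. [cite: LyonsPeres2016, §5.3 Prop. 5.11] -/
theorem sq_sum_landing_le (p : unitInterval) (n a : ℕ) :
    (∑ v ∈ (Finset.Icc (0 : Site 3) ![(a : ℤ), n, n]).filter (fun y => y 0 = (a : ℤ)),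
        (bondPercolation (zdGraph 3) p).real
          (linked (↑(Finset.Icc (0 : Site 3) ![(a : ℤ), n, n]) : Set (Site 3))
            {y : Site 3 | y ∈ Finset.Icc (0 : Site 3) ![(a : ℤ), n, n] ∧ y 0 = 0} {v})) ^ 2 ≤
      (bondPercolation (zdGraph 3) p).real (boxCross (![(a : ℤ), n, n] : Site 3) 0) *
        ∑ v ∈ (Finset.Icc (0 : Site 3) ![(a : ℤ), n, n]).filter (fun y => y 0 = (a : ℤ)),
          ∑ w ∈ (Finset.Icc (0 : Site 3) ![(a : ℤ), n, n]).filter (fun y => y 0 = (a : ℤ)),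
            (bondPercolation (zdGraph 3) p).real
              (linked (↑(Finset.Icc (0 : Site 3) ![(a : ℤ), n, n]) : Set (Site 3))
                  {y : Site 3 | y ∈ Finset.Icc (0 : Site 3) ![(a : ℤ), n, n] ∧ y 0 = 0} {v} ∩
                linked (↑(Finset.Icc (0 : Site 3) ![(a : ℤ), n, n]) : Set (Site 3))
                  {y : Site 3 | y ∈ Finset.Icc (0 : Site 3) ![(a : ℤ), n, n] ∧ y 0 = 0} {w}) := by
  classical
  set μ := bondPercolation (zdGraph 3) p with hμ
  set Face := (Finset.Icc (0 : Site 3) ![(a : ℤ), n, n]).filter (fun y => y 0 = (a : ℤ)) with hFace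
  set Lv : Site 3 → Set (BondConfig (Site 3)) := fun v =>
    linked (↑(Finset.Icc (0 : Site 3) ![(a : ℤ), n, n]) : Set (Site 3))
      {y : Site 3 | y ∈ Finset.Icc (0 : Site 3) ![(a : ℤ), n, n] ∧ y 0 = 0} {v} with hLv
  have hmeas : ∀ v ∈ Face, MeasurableSet (Lv v) := fun v _ => measurableSet_linked _ _ _
  have key := sq_sum_measureReal_le_measureReal_biUnion_mul_sum μ Face Lv hmeas
  have hU : μ.real (⋃ v ∈ Face, Lv v) ≤ μ.real (boxCross (![(a : ℤ), n, n] : Site 3) 0) :=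
    measureReal_mono (biUnion_landing_subset_boxCross n a) (measure_ne_top _ _)
  have hS : 0 ≤ ∑ v ∈ Face, ∑ w ∈ Face, μ.real (Lv v ∩ Lv w) :=
    Finset.sum_nonneg fun v _ => Finset.sum_nonneg fun w _ => measureReal_nonneg
  exact key.trans (mul_le_mul_of_nonneg_right hU hS)

/-- **Criterion form:** `Σ_{v,w} τ_F(v,w) ≤ K·(Σ_v τ_F(v))²` with `Σ_v τ_F(v) > 0` gives `1/K ≤ P_p(boxCross ![a,n,n] 0)`.
[cite: LyonsPeres2016, §5.3 Prop. 5.11] -/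
theorem le_real_boxCross_of_landing_secondMoment (p : unitInterval) {n a : ℕ} {K : ℝ} (hK : 0 < K)
    (hpos : 0 < ∑ v ∈ (Finset.Icc (0 : Site 3) ![(a : ℤ), n, n]).filter (fun y => y 0 = (a : ℤ)),
        (bondPercolation (zdGraph 3) p).real
          (linked (↑(Finset.Icc (0 : Site 3) ![(a : ℤ), n, n]) : Set (Site 3))
            {y : Site 3 | y ∈ Finset.Icc (0 : Site 3) ![(a : ℤ), n, n] ∧ y 0 = 0} {v}))
    (hpair : ∑ v ∈ (Finset.Icc (0 : Site 3) ![(a : ℤ), n, n]).filter (fun y => y 0 = (a : ℤ)),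
          ∑ w ∈ (Finset.Icc (0 : Site 3) ![(a : ℤ), n, n]).filter (fun y => y 0 = (a : ℤ)),
            (bondPercolation (zdGraph 3) p).real
              (linked (↑(Finset.Icc (0 : Site 3) ![(a : ℤ), n, n]) : Set (Site 3))
                  {y : Site 3 | y ∈ Finset.Icc (0 : Site 3) ![(a : ℤ), n, n] ∧ y 0 = 0} {v} ∩
                linked (↑(Finset.Icc (0 : Site 3) ![(a : ℤ), n, n]) : Set (Site 3))
                  {y : Site 3 | y ∈ Finset.Icc (0 : Site 3) ![(a : ℤ), n, n] ∧ y 0 = 0} {w}) ≤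
        K * (∑ v ∈ (Finset.Icc (0 : Site 3) ![(a : ℤ), n, n]).filter (fun y => y 0 = (a : ℤ)),
          (bondPercolation (zdGraph 3) p).real
            (linked (↑(Finset.Icc (0 : Site 3) ![(a : ℤ), n, n]) : Set (Site 3))
              {y : Site 3 | y ∈ Finset.Icc (0 : Site 3) ![(a : ℤ), n, n] ∧ y 0 = 0} {v})) ^ 2) :
    1 / K ≤ (bondPercolation (zdGraph 3) p).real (boxCross (![(a : ℤ), n, n] : Site 3) 0) := by
  have h := (sq_sum_landing_le p n a).trans (mul_le_mul_of_nonneg_left hpair measureReal_nonneg)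
  have hm2 : 0 < (∑ v ∈ (Finset.Icc (0 : Site 3) ![(a : ℤ), n, n]).filter (fun y => y 0 = (a : ℤ)),
      (bondPercolation (zdGraph 3) p).real
        (linked (↑(Finset.Icc (0 : Site 3) ![(a : ℤ), n, n]) : Set (Site 3))
          {y : Site 3 | y ∈ Finset.Icc (0 : Site 3) ![(a : ℤ), n, n] ∧ y 0 = 0} {v})) ^ 2 := by positivity
  rw [div_le_iff₀ hK]
  rw [← mul_assoc] at h
  have : 1 ≤ (bondPercolation (zdGraph 3) p).real (boxCross (![(a : ℤ), n, n] : Site 3) 0) * K :=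
    le_of_mul_le_mul_right (by rwa [one_mul]) hm2
  linarith [this]

/-- **Pair quasi-multiplicativity of face-to-point connectivities ⇒ `HardCrossingLowerBound k`** (at `p_c(ℤ³)`): if for every `n ≥ 1`
the block `{0..kn}×{0..n}²` satisfies `Σ_v τ_F(v) > 0` and `Σ_{v,w} τ_F(v,w) ≤ K (Σ_v τ_F(v))²` with one `K > 0`, then its lengthwise
crossing has probability `≥ 1/K` for all `n ≥ 1`.  `k = 1` is the cube (`hardShape 1 n = cubeShape n` up to `1·n = n`): uniform cube
crossing at `p_c` ⇐ a scale-uniform pair bound for the face-to-point function (OPEN, RSW-flavoured; census R22f prices `K`).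
[cite: LyonsPeres2016, §5.3 Prop. 5.11] [cite: Kesten1982, §3.3 (3.32)] -/
theorem hardCrossingLowerBound_of_landing_secondMoment {k : ℕ} {K : ℝ} (hK : 0 < K)
    (h : ∀ n : ℕ, 1 ≤ n →
      0 < ∑ v ∈ (Finset.Icc (0 : Site 3) ![((k * n : ℕ) : ℤ), n, n]).filter (fun y => y 0 = ((k * n : ℕ) : ℤ)),
          (bondPercolation (zdGraph 3) (criticalProbI 3)).real
            (linked (↑(Finset.Icc (0 : Site 3) ![((k * n : ℕ) : ℤ), n, n]) : Set (Site 3))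
              {y : Site 3 | y ∈ Finset.Icc (0 : Site 3) ![((k * n : ℕ) : ℤ), n, n] ∧ y 0 = 0} {v}) ∧
      ∑ v ∈ (Finset.Icc (0 : Site 3) ![((k * n : ℕ) : ℤ), n, n]).filter (fun y => y 0 = ((k * n : ℕ) : ℤ)),
          ∑ w ∈ (Finset.Icc (0 : Site 3) ![((k * n : ℕ) : ℤ), n, n]).filter (fun y => y 0 = ((k * n : ℕ) : ℤ)),
            (bondPercolation (zdGraph 3) (criticalProbI 3)).real
              (linked (↑(Finset.Icc (0 : Site 3) ![((k * n : ℕ) : ℤ), n, n]) : Set (Site 3))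
                  {y : Site 3 | y ∈ Finset.Icc (0 : Site 3) ![((k * n : ℕ) : ℤ), n, n] ∧ y 0 = 0} {v} ∩
                linked (↑(Finset.Icc (0 : Site 3) ![((k * n : ℕ) : ℤ), n, n]) : Set (Site 3))
                  {y : Site 3 | y ∈ Finset.Icc (0 : Site 3) ![((k * n : ℕ) : ℤ), n, n] ∧ y 0 = 0} {w}) ≤
        K * (∑ v ∈ (Finset.Icc (0 : Site 3) ![((k * n : ℕ) : ℤ), n, n]).filter (fun y => y 0 = ((k * n : ℕ) : ℤ)),
          (bondPercolation (zdGraph 3) (criticalProbI 3)).real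
            (linked (↑(Finset.Icc (0 : Site 3) ![((k * n : ℕ) : ℤ), n, n]) : Set (Site 3))
              {y : Site 3 | y ∈ Finset.Icc (0 : Site 3) ![((k * n : ℕ) : ℤ), n, n] ∧ y 0 = 0} {v})) ^ 2) :
    HardCrossingLowerBound k := by
  refine ⟨1 / K, by positivity, fun n hn => ?_⟩
  obtain ⟨hpos, hpair⟩ := h n hn
  have hshape : hardShape k n = (![((k * n : ℕ) : ℤ), n, n] : Site 3) := by
    ext j; fin_cases j <;> simp [hardShape]
  rw [hshape]
  exact le_real_boxCross_of_landing_secondMoment (criticalProbI 3) hK hpos hpair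

/-! ## Appended (lead gen 5): `{L ≥ 1} = {block crossed}` exactly -/

/-- **On lattice configurations a crossing lands somewhere:** if `ω ⊆ E(ℤ³)` and `ω ∈ boxCross ![a,n,n] 0` then some far-face site
is landed (`ω ∈ ⋃_{v ∈ F_a} 𝓛_v`). [cite: Kesten1982, §3.3 (3.32)] -/
theorem mem_biUnion_landing_of_mem_boxCross {n a : ℕ} {ω : BondConfig (Site 3)} (hω : ω ⊆ (zdGraph 3).edgeSet)
    (h : ω ∈ boxCross (![(a : ℤ), n, n] : Site 3) 0) :
    ω ∈ ⋃ v ∈ (Finset.Icc (0 : Site 3) ![(a : ℤ), n, n]).filter (fun y => y 0 = (a : ℤ)),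
      linked (↑(Finset.Icc (0 : Site 3) ![(a : ℤ), n, n]) : Set (Site 3))
        {y : Site 3 | y ∈ Finset.Icc (0 : Site 3) ![(a : ℤ), n, n] ∧ y 0 = 0} {v} := by
  obtain ⟨x, hx, y, hy, hx0, hyL, hconn⟩ := h
  have hya : y 0 = (a : ℤ) := by rw [hyL]; simp
  simp only [Set.mem_iUnion, exists_prop]
  exact ⟨y, Finset.mem_filter.2 ⟨hy, hya⟩,
    mem_linked_iff.2 ⟨x, ⟨hx, hx0⟩, y, rfl, Rsw3.mem_inConn_of_mem_openConnIn hω hx hconn⟩⟩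

/-- **`P_p(boxCross ![a,n,n] 0) = P_p(L ≥ 1)`** — the block crossing has the probability of the union of the landing events over
the far face (the census's identity `P(B) = P(L ≥ 1)`, exact). [cite: Kesten1982, §3.3 (3.32)] -/
theorem real_boxCross_eq_real_biUnion_landing (p : unitInterval) (n a : ℕ) :
    (bondPercolation (zdGraph 3) p).real (boxCross (![(a : ℤ), n, n] : Site 3) 0) =
      (bondPercolation (zdGraph 3) p).real
        (⋃ v ∈ (Finset.Icc (0 : Site 3) ![(a : ℤ), n, n]).filter (fun y => y 0 = (a : ℤ)),
          linked (↑(Finset.Icc (0 : Site 3) ![(a : ℤ), n, n]) : Set (Site 3))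
            {y : Site 3 | y ∈ Finset.Icc (0 : Site 3) ![(a : ℤ), n, n] ∧ y 0 = 0} {v}) := by
  refine le_antisymm ?_ (measureReal_mono (biUnion_landing_subset_boxCross n a) (measure_ne_top _ _))
  exact DCT16.real_mono_of_forall_subset_edgeSet (zdGraph 3) p fun ω hω h =>
    mem_biUnion_landing_of_mem_boxCross hω h

end Summit.CriticalPhenomena.PercolationContinuityZ3.Theorems.Crossing

end
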